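import Literature.AnabelianGeometry.SemiGraphs.SgAToProfinite
import Mathlib.CategoryTheory.Galois.Equivalence
import HarnessLib

/-!
# [SemiAnbd] §2/§3: `𝒢` versus `B(𝒢.toProfinite)` — the constituentwise comparison (bridge B3)

Mochizuki, *Semi-graphs of anabelioids*, Publ. RIMS **42** (2006), §2 p. 23: "we shall denote the
semi-graph of anabelioids `{B(Π_v), B(Π_e), B(b_*)}` … by `𝒢`" — i.e. a semi-graph of anabelioids IS
(equivalent to) the semi-graph of anabelioids of its profinite presentation; [GeoAn] §1.1 / [SGA1]
V §4: a connected anabelioid with a basepoint `F` is equivalent to `B(Aut F)` (Mathlib's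
`PreGaloisCategory.functorToContAction`, an equivalence) (kurims `paper:url-f33ace170ff4`).
[cite: MochizukiSemiAnbd2006, Def. 2.1 p.23]

Step B3 of the (R1) bridge (HOME/staging/L3/L3-t3/MERGE-MAP.md §4 (1); interface owner
abc-iut-L3-t3), over B1 `SgAToProfinite.lean`: the data comparing abc-iut-L3-t1's `𝒢` with
abc-iut-L3-t2's `𝒢.toProfinite.toAnab = {B(Π_v), B(Π_e), B(b_*)}`:

* `SemiGraphOfAnabelioids.compareV 𝒢 v : 𝒢_v ⥤ B(Π_v)` and `compareE 𝒢 e : 𝒢_e ⥤ B(Π_e)` — Mathlib's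
  fibre-functor equivalences at the canonical basepoints (`compareV_isEquivalence`,
  `compareE_isEquivalence`), with underlying finite sets the fibres (`compareV_obj_obj_V`);
* `SemiGraphOfAnabelioids.compareBranchIso 𝒢 b v h :
  compareV v ⋙ (b_*)^* ≅ b^* ⋙ compareE e` — THE 2-CELL ALONG A BRANCH: restriction along
  `b_* = α_b ⋆ π₁(b^*)` of the `Π_v`-set `F_v(A)` is, via the chosen path `α_b` (B1 `branchPath`),
  the `Π_e`-set `F_e(b^* A)`; components `(α_b)_A⁻¹`, equivariance = the definition of `b_*`,
  naturality = naturality of `α_b`.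

These are exactly the components `φ_v`, `φ_e`, `φ_b` of a 1-morphism `𝒢.toProfinite.toAnab → 𝒢`
over the identity of the underlying semi-graph whose constituents are EQUIVALENCES (an isomorphism
of semi-graphs of anabelioids in the sense of Def. 2.2 (ii) / Rmk 2.4.2).  They are delivered as
data rather than as a term of t1's `SemiGraphOfAnabelioids.Hom` only because `Hom` requires both
semi-graphs of anabelioids at the SAME constituent universe, whereas `B(Π)` (`BCat`, Mathlib's
`ContAction FintypeCat.{u} Π`) lives one universe above `𝒢_v : Type u` (recorded merge remark; a
universe-polymorphic `Hom` or a `ULift` of `𝒢` would bundle them verbatim).  Sequel (B4): tempered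
arrows of `SgA` through `CovObj.coveringGraph` of `𝒢.toProfinite` (Def. 3.5 (ii)).  Definitions and
bookkeeping only; nothing of the paper is asserted; no side taken on [IUTchIII] Cor. 3.12.
-/

noncomputable section

namespace Literature.AnabelianGeometry.SemiGraphs

open CategoryTheory CategoryTheory.Limits CategoryTheory.PreGaloisCategory
open Literature.AnabelianGeometry.Anabelioids
open Literature.AlgebraicGeometry.Frobenioids (BCat)
open scoped FintypeCatDiscrete

universe u

namespace SemiGraphOfAnabelioids

variable (𝒢 : SemiGraphOfAnabelioids.{u, u, u})

/-! ### The comparison functors at vertices and edges -/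

/-- **`𝒢_v ⥤ B(Π_v)`**: the fibre-functor equivalence of the Galois category `𝒢_v` at its canonical
basepoint (Mathlib's `functorToContAction`; `Π_v = Aut F_v` as in `𝒢.toProfinite`).
[cite: MochizukiSemiAnbd2006, Def. 2.1 p.23] -/
abbrev compareV (v : 𝒢.graph.Vertex) : 𝒢.V v ⥤ BCat (Aut (𝒢.fibV v)) :=
  functorToContAction (𝒢.fibV v)

/-- **`𝒢_e ⥤ B(Π_e)`**: the fibre-functor equivalence of `𝒢_e` at its canonical basepoint.
[cite: MochizukiSemiAnbd2006, Def. 2.1 p.23] -/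
abbrev compareE (e : 𝒢.graph.Edge) : 𝒢.E e ⥤ BCat (Aut (𝒢.fibE e)) :=
  functorToContAction (𝒢.fibE e)

/-- `𝒢_v ⥤ B(Π_v)` is an equivalence of categories ([SGA1] V §4 / [GeoAn] §1.1; Mathlib).
[cite: MochizukiSemiAnbd2006, Def. 2.1 p.23] -/
theorem compareV_isEquivalence (v : 𝒢.graph.Vertex) : (𝒢.compareV v).IsEquivalence := inferInstance

/-- `𝒢_e ⥤ B(Π_e)` is an equivalence of categories. [cite: MochizukiSemiAnbd2006, Def. 2.1 p.23] -/
theorem compareE_isEquivalence (e : 𝒢.graph.Edge) : (𝒢.compareE e).IsEquivalence := inferInstance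

/-- The underlying finite set of the `Π_v`-set attached to `A ∈ 𝒢_v` is the fibre `F_v(A)`.
[cite: MochizukiSemiAnbd2006, Def. 2.1 p.23] -/
theorem compareV_obj_obj_V (v : 𝒢.graph.Vertex) (A : 𝒢.V v) :
    ((𝒢.compareV v).obj A).obj.V = (𝒢.fibV v).obj A := rfl

/-- The underlying finite set of the `Π_e`-set attached to `B ∈ 𝒢_e` is the fibre `F_e(B)`.
[cite: MochizukiSemiAnbd2006, Def. 2.1 p.23] -/
theorem compareE_obj_obj_V (e : 𝒢.graph.Edge) (B : 𝒢.E e) :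
    ((𝒢.compareE e).obj B).obj.V = (𝒢.fibE e).obj B := rfl

/-- The comparison functors are exact (equivalences preserve finite limits).
[cite: MochizukiSemiAnbd2006, Def. 2.1 p.23] -/
theorem compareV_preservesFiniteLimits (v : 𝒢.graph.Vertex) :
    PreservesFiniteLimits (𝒢.compareV v) := inferInstance

/-- The comparison functors are exact (equivalences preserve finite colimits).
[cite: MochizukiSemiAnbd2006, Def. 2.1 p.23] -/
theorem compareV_preservesFiniteColimits (v : 𝒢.graph.Vertex) :
    PreservesFiniteColimits (𝒢.compareV v) := inferInstance

/-! ### The 2-cell along a branch -/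

section Branch

variable (b : 𝒢.graph.Branch) (v : 𝒢.graph.Vertex) (h : 𝒢.graph.abuts b = some v)

/-- The pull-back functor of `B(b_*)` in `𝒢.toProfinite.toAnab` is restriction along
`b_* = 𝒢.toProfinite.brHom b v h` (definitionally, `toAnab_pull_pullback`).
[cite: MochizukiSemiAnbd2006, Def. 2.1 p.23] -/
theorem toProfinite_toAnab_pull (b : 𝒢.graph.Branch) (v : 𝒢.graph.Vertex)
    (h : 𝒢.graph.abuts b = some v) :
    (𝒢.toProfinite.toAnab.pull b v h).pullback =
      ContAction.res FintypeCat.{u} (𝒢.toProfinite.brHom b v h) :=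
  rfl

/-- The component at `A ∈ 𝒢_v` of the branch 2-cell, on underlying finite sets: the chosen path
`(α_b)_A : F_e(b^* A) ≅ F_v(A)`, reversed. [cite: MochizukiSemiAnbd2006, Def. 2.1 pp.23-24] -/
def compareBranchFibreIso (A : 𝒢.V v) :
    (𝒢.fibV v).obj A ≅ (𝒢.fibE (𝒢.graph.edgeOf b)).obj ((𝒢.pull b v h).pullback.obj A) :=
  ((𝒢.branchPath b v h).app A).symm

/-- Equivariance of `(α_b)_A⁻¹`: for `σ ∈ Π_e`, acting by `b_* σ = α_b ⋆ π₁(b^*) σ` on `F_v(A)` and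
then applying `(α_b)_A⁻¹` is applying `(α_b)_A⁻¹` and then acting by `σ` on `F_e(b^* A)` — the
DEFINITION of `b_*` (B1 `toProfinite_brHom_apply`). [cite: MochizukiSemiAnbd2006, Def. 2.1 pp.23-24] -/
theorem compareBranchFibreIso_equivariant (A : 𝒢.V v) (σ : Aut (𝒢.fibE (𝒢.graph.edgeOf b)))
    (x : (𝒢.fibV v).obj A) :
    (𝒢.compareBranchFibreIso b v h A).hom ((𝒢.brHomProfinite b v h σ) • x) =
      σ • (𝒢.compareBranchFibreIso b v h A).hom x := by
  rw [mulAction_def, mulAction_def]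
  change ((𝒢.branchPath b v h).app A).inv
      ((Aut.autMulEquivOfIso (𝒢.branchPath b v h)
        (pi1Map (𝒢.pull b v h).pullback (𝒢.fibE (𝒢.graph.edgeOf b)) σ)).hom.app A x) = _
  change ((𝒢.branchPath b v h).app A).inv
      (((𝒢.branchPath b v h).inv ≫
        (pi1Map (𝒢.pull b v h).pullback (𝒢.fibE (𝒢.graph.edgeOf b)) σ).hom ≫
          (𝒢.branchPath b v h).hom).app A x) =
    σ.hom.app ((𝒢.pull b v h).pullback.obj A) (((𝒢.branchPath b v h).app A).inv x)
  rw [NatTrans.comp_app, NatTrans.comp_app, pi1Map_hom_app]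
  change ((𝒢.branchPath b v h).hom.app A ≫ (𝒢.branchPath b v h).inv.app A)
      (σ.hom.app ((𝒢.pull b v h).pullback.obj A) ((𝒢.branchPath b v h).inv.app A x)) = _
  rw [Iso.hom_inv_id_app]
  rfl

/-- The component at `A ∈ 𝒢_v` of the branch 2-cell, as an isomorphism of continuous finite
`Π_e`-sets `(b_*)^*(F_v A) ≅ F_e(b^* A)`. [cite: MochizukiSemiAnbd2006, Def. 2.1 pp.23-24] -/
def compareBranchIsoApp (A : 𝒢.V v) :
    (𝒢.compareV v ⋙ (𝒢.toProfinite.toAnab.pull b v h).pullback).obj A ≅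
      ((𝒢.pull b v h).pullback ⋙ 𝒢.compareE (𝒢.graph.edgeOf b)).obj A :=
  ObjectProperty.isoMk _ (Action.mkIso (𝒢.compareBranchFibreIso b v h A) fun σ => by
    ext x
    exact 𝒢.compareBranchFibreIso_equivariant b v h A σ x)

/-- Underlying map of the component: `(α_b)_A⁻¹`. [cite: MochizukiSemiAnbd2006, Def. 2.1 pp.23-24] -/
theorem compareBranchIsoApp_hom_hom_hom (A : 𝒢.V v) :
    (𝒢.compareBranchIsoApp b v h A).hom.hom.hom = (𝒢.compareBranchFibreIso b v h A).hom := rfl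

/-- **The 2-cell along the branch `b`**: `compareV v ⋙ (b_*)^* ≅ b^* ⋙ compareE e` as functors
`𝒢_v ⥤ B(Π_e)` — the `φ_b` of the comparison 1-morphism `{B(Π_v), B(Π_e), B(b_*)} → 𝒢`
(components `(α_b)_A⁻¹`; naturality in `A` is naturality of the path `α_b`).
[cite: MochizukiSemiAnbd2006, Rem. 2.4.2 p.26] -/
def compareBranchIso :
    𝒢.compareV v ⋙ (𝒢.toProfinite.toAnab.pull b v h).pullback ≅
      (𝒢.pull b v h).pullback ⋙ 𝒢.compareE (𝒢.graph.edgeOf b) :=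
  NatIso.ofComponents (fun A => 𝒢.compareBranchIsoApp b v h A) fun {A A'} u => by
    apply ObjectProperty.hom_ext
    apply Action.Hom.ext
    ext x
    change (𝒢.compareBranchFibreIso b v h A').hom ((𝒢.fibV v).map u x) =
      (𝒢.fibE (𝒢.graph.edgeOf b)).map ((𝒢.pull b v h).pullback.map u)
        ((𝒢.compareBranchFibreIso b v h A).hom x)
    exact NatTrans.naturality_apply (𝒢.branchPath b v h).inv u x

/-- Components of the 2-cell on underlying finite sets: `(α_b)_A⁻¹`.
[cite: MochizukiSemiAnbd2006, Rem. 2.4.2 p.26] -/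
theorem compareBranchIso_hom_app_hom_hom (A : 𝒢.V v) :
    ((𝒢.compareBranchIso b v h).hom.app A).hom.hom = ((𝒢.branchPath b v h).app A).inv := rfl

end Branch

/-! ### At the ambient category of §§4–5 -/

/-- For an object `G` of `SgA`, the constituent `𝒢_v` is equivalent to `B(SgA.piV G v)` (the same
comparison functor, `Π_v` on the nose). [cite: MochizukiSemiAnbd2006, Def. 2.1 p.23] -/
theorem _root_.Literature.AnabelianGeometry.SemiGraphs.SgAQuot.SgA.compareV_isEquivalence
    (G : SgAQuot.SgA.{u, u, u}) (v : G.toSgA.graph.Vertex) :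
    (G.toSgA.compareV v : G.toSgA.V v ⥤ BCat (G.piV v)).IsEquivalence :=
  G.toSgA.compareV_isEquivalence v

end SemiGraphOfAnabelioids

end Literature.AnabelianGeometry.SemiGraphs

end
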